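import Literature.NumberTheory.EllipticCurves.KubertTateFiveKummerDivisor
import Literature.NumberTheory.EllipticCurves.KubertTateSevenVeluIsogeny
import Literature.NumberTheory.EllipticCurves.KubertTateSevenKummerValuation
import HarnessLib

/-!
# The divisor of the Kummer function `f_T = x²y - n(m+n)x³ + n³(2m+n)xy - m²n⁴x² + m²n⁶y` on the
# Kubert–Tate `7`-torsion family: `div f_T = 7(T) - 7(O)`, over any field

PROOF-ONLY file (theorems and three small definitions with bodies), topic `NumberTheory/EllipticCurves`;
the `7`-torsion sibling of `KubertTateFiveKummerDivisor` (whose structure it follows line by line).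
For the integral model `E_{m,n} = kubertTateSeven m n : y² + (n² + mn - m²)xy + m²n³(n-m)y = x³ + m²n(n-m)x²`
of the universal elliptic curve with a point `T = (0,0)` of order `7` (Kubert 1976, Table 3, `N = 7`;
tree `KubertTateSeven`, `KubertTateSevenVeluIsogeny`) over a field `F` of characteristic `0` with
`E_{m,n}` elliptic (`mn(m - n)(m³ - 8m²n + 5mn² + n³) ≠ 0`), the function

  `f_T = x²y - n(m+n)x³ + n³(2m+n)xy - m²n⁴x² + m²n⁶y ∈ F̄(E_{m,n})`

has divisor `7(T) - 7(O)`: it is the Kummer function of the descent through the dual of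
`E → E/⟨T⟩` (Silverman, *AEC*, Exercise 10.1(c): `E(K)/φ̂(E'(K)) ↪ Kˣ/Kˣ⁷`, `P ↦ f_T(P)`; T. Fisher,
JEMS 3 (2001), §§1–2). With the tree's point-indexed order function `WeierstrassFunctionField.ord`:

* `ord_zero_kummerFn₇` — `ord_O f_T = -7` (`f_T = (-n(m+n)x³ - m²n⁴x²)·1 + (x² + n³(2m+n)x + m²n⁶)·y`,
  norm degree `max(2·deg(·), 2·2 + 3) = 7`);
* `eq_zero_of_kummer₇_eq_zero` — the only affine zero is `T` (`f_T · f_{-T} = -x⁷`, file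
  `KubertTateSevenKummerValuation`, and `f_T(0, y) = m²n⁶ y`);
* `ord_Tbar_kummerFn₇` — `ord_T f_T = 7` (degree of a principal divisor is `0`);
* `ord_kummerFn₇` — **`ord_Q f_T = 7([Q = T̄] - [Q = O])`**, the divisor hypothesis of the tree's
  `WeierstrassCurve.exists_stableCoset_of_kummer_eq_pow` (`IsogenyDescentWeilFunction`);
* `hasValueAt_kummerFn₇` — the value of `f_T` at affine points.

## References

* [SilvermanAEC2009] J. H. Silverman, *The Arithmetic of Elliptic Curves*, 2nd ed. (2009),
  Exercise 10.1 (PDF p. 304), Prop. II.3.1, III.§8.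
* [Fisher2001FiveSevenDescent] T. Fisher, JEMS 3 (2001), §§1–2 (the `7`-descent on the Tate
  normal form).
* [Kubert1976] D. S. Kubert, *Universal bounds on the torsion of elliptic curves*, Table 3 (N = 7).

## Design

Generic in the field `F` and in `m n : F`, with `[(kubertTateSeven m n).IsElliptic]` as an instance
argument; so the file serves the curves `E_{m,n}` over `ℚ` and over every completion `ℚ_v` alike.
The marked point `T̄` is `KubertTateSevenVelu.Tbar` of `KubertTateSevenVeluIsogeny`.
-/

noncomputable section

open scoped Classical WithZero Polynomial.Bivariate
open Polynomial WeierstrassCurve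
open Literature.NumberTheory.EllipticCurves.WeierstrassFunctionField WeierstrassCurve.geomPoints

namespace Literature.NumberTheory.EllipticCurves

namespace KubertTateSevenKummer

open Literature.NumberTheory.EllipticCurves KubertTateSevenVelu

universe u

variable {F : Type u} [Field F] (m n : F) [hE : (kubertTateSeven m n).IsElliptic]

/-! ### The curve over `F̄` -/

omit hE in
/-- The coefficients of `E_{m,n} ⊗ F̄`: `kubertTateSeven (m : F̄) (n : F̄)`. [cite: Kubert1976, Table 3 (N = 7)] -/
theorem baseChange_eq : (kubertTateSeven m n).baseChange (AlgebraicClosure F) =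
    kubertTateSeven (algebraMap F (AlgebraicClosure F) m) (algebraMap F (AlgebraicClosure F) n) :=
  map_kubertTateSeven m n _

/-- `m ≠ 0`, `n ≠ 0` in `F̄` when the curve is elliptic. [cite: Kubert1976, Table 3 (N = 7)] -/
theorem m_n_ne_zero : algebraMap F (AlgebraicClosure F) m ≠ 0 ∧ algebraMap F (AlgebraicClosure F) n ≠ 0 := by
  obtain ⟨hm, hn, -, -⟩ := ne_zero_of_isElliptic m n
  exact ⟨(_root_.map_ne_zero _).mpr hm, (_root_.map_ne_zero _).mpr hn⟩

/-! ### The Kummer function -/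

/-- `f_T` as a two-variable polynomial: `X₀² X₁ - n(m+n) X₀³ + n³(2m+n) X₀ X₁ - m²n⁴ X₀² + m²n⁶ X₁`.
[cite: SilvermanAEC2009, Exercise 10.1(c) (PDF p. 304)] [cite: Fisher2001FiveSevenDescent, §1] -/
def kummerPoly₇ : MvPolynomial (Fin 2) (AlgebraicClosure F) :=
  MvPolynomial.X 0 ^ 2 * MvPolynomial.X 1
    - MvPolynomial.C (algebraMap F (AlgebraicClosure F) n *
        (algebraMap F (AlgebraicClosure F) m + algebraMap F (AlgebraicClosure F) n)) * MvPolynomial.X 0 ^ 3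
    + MvPolynomial.C (algebraMap F (AlgebraicClosure F) n ^ 3 *
        (2 * algebraMap F (AlgebraicClosure F) m + algebraMap F (AlgebraicClosure F) n)) *
      MvPolynomial.X 0 * MvPolynomial.X 1
    - MvPolynomial.C (algebraMap F (AlgebraicClosure F) m ^ 2 * algebraMap F (AlgebraicClosure F) n ^ 4) *
      MvPolynomial.X 0 ^ 2
    + MvPolynomial.C (algebraMap F (AlgebraicClosure F) m ^ 2 * algebraMap F (AlgebraicClosure F) n ^ 6) *
      MvPolynomial.X 1

/-- The `y`-free part of `f_T` in the basis `1, y`: `p₀ = -n(m+n) x³ - m²n⁴ x²`.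
[cite: SilvermanAEC2009, Exercise 10.1(c) (PDF p. 304)] -/
def kummerP₀ : (AlgebraicClosure F)[X] :=
  -(C (algebraMap F (AlgebraicClosure F) n *
      (algebraMap F (AlgebraicClosure F) m + algebraMap F (AlgebraicClosure F) n)) * X ^ 3)
    - C (algebraMap F (AlgebraicClosure F) m ^ 2 * algebraMap F (AlgebraicClosure F) n ^ 4) * X ^ 2

/-- The coefficient of `y` in `f_T`: `p₁ = x² + n³(2m+n) x + m²n⁶` (monic of degree `2`).
[cite: SilvermanAEC2009, Exercise 10.1(c) (PDF p. 304)] -/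
def kummerP₁ : (AlgebraicClosure F)[X] :=
  X ^ 2 + C (algebraMap F (AlgebraicClosure F) n ^ 3 *
      (2 * algebraMap F (AlgebraicClosure F) m + algebraMap F (AlgebraicClosure F) n)) * X
    + C (algebraMap F (AlgebraicClosure F) m ^ 2 * algebraMap F (AlgebraicClosure F) n ^ 6)

omit hE in
/-- `p₁` is monic. [folklore] -/
private theorem monic_kummerP₁ : (kummerP₁ m n).Monic := by
  unfold kummerP₁; monicity!

omit hE in
/-- `deg p₁ = 2`. [folklore] -/
private theorem natDegree_kummerP₁ : (kummerP₁ m n).natDegree = 2 := by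
  unfold kummerP₁; compute_degree!

omit hE in
/-- `deg p₀ ≤ 3`. [folklore] -/
private theorem natDegree_kummerP₀_le : (kummerP₀ m n).natDegree ≤ 3 := by
  unfold kummerP₀; compute_degree

/-- `p₀ ≠ 0` (its `x²`-coefficient `-m²n⁴` is non-zero). [folklore] -/
private theorem kummerP₀_ne_zero : kummerP₀ m n ≠ 0 := by
  obtain ⟨hm, hn, -, -⟩ := ne_zero_of_isElliptic m n
  intro h0
  have := congrArg (fun p : (AlgebraicClosure F)[X] ↦ p.coeff 2) h0
  simp only [kummerP₀, coeff_sub, coeff_neg, coeff_C_mul, coeff_X_pow, coeff_zero] at this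
  norm_num at this
  rcases this with h | h
  · exact hm h
  · exact hn h

omit hE in
/-- `kummerPoly₇` under the identification `F̄[x][y] ≃ F̄[X₀, X₁]`: `C p₀ + C p₁ · Y`.
[cite: SilvermanAEC2009, Exercise 10.1(c) (PDF p. 304)] -/
theorem equivMvPolynomial_symm_kummerPoly₇ :
    (Polynomial.Bivariate.equivMvPolynomial (AlgebraicClosure F)).symm (kummerPoly₇ m n) =
      C (kummerP₀ m n) + C (kummerP₁ m n) * Y := by
  simp only [kummerPoly₇, kummerP₀, kummerP₁, map_add, map_sub, map_mul, map_pow,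
    Polynomial.Bivariate.equivMvPolynomial_symm_X_0,
    Polynomial.Bivariate.equivMvPolynomial_symm_X_1, Polynomial.Bivariate.equivMvPolynomial_symm_C,
    map_neg, map_ofNat]
  ring

/-- **The Kummer function `f_T ∈ F̄(E_{m,n})`** (evaluation of `kummerPoly₇` at the generic point).
[cite: SilvermanAEC2009, Exercise 10.1(c) (PDF p. 304)] [cite: Fisher2001FiveSevenDescent, §1] -/
def kummerFn₇ : (kubertTateSeven m n).geomFunctionField := (kubertTateSeven m n).evalGeneric (kummerPoly₇ m n)

/-- `f_T` in the coordinate ring `F̄[E_{m,n}]`, in the basis `1, y` over `F̄[x]`: `p₀ · 1 + p₁ · y`.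
[cite: SilvermanAEC2009, Exercise 10.1(c) (PDF p. 304)] -/
def kummerCR₇ : Affine.CoordinateRing ((kubertTateSeven m n).baseChange (AlgebraicClosure F)).toAffine :=
  (kummerP₀ m n) • (1 : Affine.CoordinateRing ((kubertTateSeven m n).baseChange (AlgebraicClosure F)).toAffine) +
    (kummerP₁ m n) • Affine.CoordinateRing.mk ((kubertTateSeven m n).baseChange (AlgebraicClosure F)).toAffine Y

omit hE in
/-- `f_T` reduces to `p₀ · 1 + p₁ · y` in `F̄[E_{m,n}]`. [cite: SilvermanAEC2009, Exercise 10.1(c) (PDF p. 304)] -/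
theorem mk_kummer₇_eq :
    Affine.CoordinateRing.mk ((kubertTateSeven m n).baseChange (AlgebraicClosure F)).toAffine
      (C (kummerP₀ m n) + C (kummerP₁ m n) * Y) = kummerCR₇ m n := by
  have e : ∀ p : (AlgebraicClosure F)[X], algebraMap (AlgebraicClosure F)[X]
      (Affine.CoordinateRing ((kubertTateSeven m n).baseChange (AlgebraicClosure F)).toAffine) p =
      Affine.CoordinateRing.mk ((kubertTateSeven m n).baseChange (AlgebraicClosure F)).toAffine (C p) :=
    fun p => rfl
  rw [kummerCR₇, Algebra.smul_def, Algebra.smul_def, mul_one, e, e, ← map_mul, ← map_add]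

omit hE in
/-- `f_T` is `kummerCR₇` viewed in the function field. [cite: SilvermanAEC2009, Exercise 10.1(c) (PDF p. 304)] -/
theorem kummerFn₇_eq_algebraMap :
    kummerFn₇ m n = algebraMap (Affine.CoordinateRing ((kubertTateSeven m n).baseChange (AlgebraicClosure F)).toAffine)
      (kubertTateSeven m n).geomFunctionField (kummerCR₇ m n) := by
  rw [kummerFn₇, evalGeneric_apply, ← mk_kummer₇_eq, equivMvPolynomial_symm_kummerPoly₇]

omit hE in
/-- `kummerCR₇ ≠ 0` (its `y`-component `p₁` is monic). [cite: SilvermanAEC2009, Exercise 10.1(c) (PDF p. 304)] -/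
theorem kummerCR₇_ne_zero : kummerCR₇ m n ≠ 0 := fun h0 =>
  (monic_kummerP₁ m n).ne_zero (Affine.CoordinateRing.smul_basis_eq_zero h0).2

omit hE in
/-- `f_T ≠ 0`. [cite: SilvermanAEC2009, Exercise 10.1(c) (PDF p. 304)] -/
theorem kummerFn₇_ne_zero : kummerFn₇ m n ≠ 0 := by
  rw [kummerFn₇_eq_algebraMap]
  exact (map_ne_zero_iff _ (FaithfulSMul.algebraMap_injective
    (Affine.CoordinateRing ((kubertTateSeven m n).baseChange (AlgebraicClosure F)).toAffine)
    (kubertTateSeven m n).geomFunctionField)).mpr (kummerCR₇_ne_zero m n)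

omit hE in
/-- `f_T(a, b) = a²b - n(m+n)a³ + n³(2m+n)ab - m²n⁴a² + m²n⁶b` as the value of the regular function
`kummerCR₇`. [cite: SilvermanAEC2009, Exercise 10.1(c) (PDF p. 304)] -/
theorem pointEval_kummerCR₇ {a b : (AlgebraicClosure F)}
    (h : ((kubertTateSeven m n).baseChange (AlgebraicClosure F)).toAffine.Equation a b) :
    pointEval h (kummerCR₇ m n) =
      a ^ 2 * b - algebraMap F (AlgebraicClosure F) n *
          (algebraMap F (AlgebraicClosure F) m + algebraMap F (AlgebraicClosure F) n) * a ^ 3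
        + algebraMap F (AlgebraicClosure F) n ^ 3 *
          (2 * algebraMap F (AlgebraicClosure F) m + algebraMap F (AlgebraicClosure F) n) * a * b
        - algebraMap F (AlgebraicClosure F) m ^ 2 * algebraMap F (AlgebraicClosure F) n ^ 4 * a ^ 2
        + algebraMap F (AlgebraicClosure F) m ^ 2 * algebraMap F (AlgebraicClosure F) n ^ 6 * b := by
  rw [← mk_kummer₇_eq, pointEval_mk]
  simp only [kummerP₀, kummerP₁, evalEval_add, evalEval_mul, evalEval_C, evalEval_X, eval_X, eval_C,
    eval_mul, eval_pow, eval_neg, eval_add, eval_sub]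
  ring

/-! ### The pole at `O` -/

/-- **`ord_O f_T = -7`**: the norm of `p₀ + p₁ y` has degree `max (2·deg p₀, 2·2 + 3) = 7`
(`deg p₀ ≤ 3`). [cite: SilvermanAEC2009, Exercise 10.1(c) (PDF p. 304)] -/
theorem ord_zero_kummerFn₇ :
    ord ((kubertTateSeven m n).baseChange (AlgebraicClosure F)).toAffine 0 (kummerFn₇ m n) = -7 := by
  have hp0 := kummerP₀_ne_zero m n
  have hp1 := (monic_kummerP₁ m n).ne_zero
  have hle := natDegree_kummerP₀_le m n
  rw [kummerFn₇_eq_algebraMap, ord_zero_algebraMap (kummerCR₇_ne_zero m n), kummerCR₇,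
    normDeg_smul_basis_eq _ _ (Or.inl hp0), if_neg hp1, if_neg hp0, natDegree_kummerP₁,
    max_eq_right (by omega)]
  norm_num

/-! ### The zeros: only `T` -/

/-- **The only zero of `f_T` on `E_{m,n}` is `T = (0, 0)`**: `f_T · f_{-T} = -x⁷` on the curve, so
`f_T(a, b) = 0` forces `a = 0` and then `m²n⁶ b = f_T(0, b) = 0`.
[cite: SilvermanAEC2009, Exercise 10.1(c) (PDF p. 304)] [cite: Fisher2001FiveSevenDescent, §1] -/
theorem eq_zero_of_kummer₇_eq_zero {m' n' a b : (AlgebraicClosure F)} (hm' : m' ≠ 0) (hn' : n' ≠ 0)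
    (he : b ^ 2 + (n' ^ 2 + m' * n' - m' ^ 2) * a * b + m' ^ 2 * n' ^ 3 * (n' - m') * b =
      a ^ 3 + m' ^ 2 * n' * (n' - m') * a ^ 2)
    (hf : a ^ 2 * b - n' * (m' + n') * a ^ 3 + n' ^ 3 * (2 * m' + n') * a * b - m' ^ 2 * n' ^ 4 * a ^ 2
      + m' ^ 2 * n' ^ 6 * b = 0) : a = 0 ∧ b = 0 := by
  have hprod := KubertTateSevenKummer.kummerFn₇_mul_kummerFn₇_neg he
  rw [hf, zero_mul] at hprod
  have ha : a = 0 := pow_eq_zero_iff (n := 7) (by norm_num) |>.mp (neg_eq_zero.mp hprod.symm)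
  refine ⟨ha, ?_⟩
  rw [ha] at hf
  have : m' ^ 2 * n' ^ 6 * b = 0 := by linear_combination hf
  exact (mul_eq_zero.mp this).resolve_left (mul_ne_zero (pow_ne_zero 2 hm') (pow_ne_zero 6 hn'))

/-- `ord_Q f_T ≥ 0` at affine `Q`. [cite: SilvermanAEC2009, Exercise 10.1(c) (PDF p. 304)] -/
theorem ord_some_kummerFn₇_nonneg {a b : (AlgebraicClosure F)}
    (h : ((kubertTateSeven m n).baseChange (AlgebraicClosure F)).toAffine.Nonsingular a b) :
    0 ≤ ord ((kubertTateSeven m n).baseChange (AlgebraicClosure F)).toAffine (.some a b h) (kummerFn₇ m n) := by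
  rw [kummerFn₇_eq_algebraMap]; exact ord_some_algebraMap_nonneg h _

/-- `ord_Q f_T > 0` at affine `Q = (a, b)` iff `f_T(a, b) = 0`. [cite: SilvermanAEC2009, Exercise 10.1(c) (PDF p. 304)] -/
theorem ord_some_kummerFn₇_pos_iff {a b : (AlgebraicClosure F)}
    (h : ((kubertTateSeven m n).baseChange (AlgebraicClosure F)).toAffine.Nonsingular a b) :
    0 < ord ((kubertTateSeven m n).baseChange (AlgebraicClosure F)).toAffine (.some a b h) (kummerFn₇ m n) ↔
      a ^ 2 * b - algebraMap F (AlgebraicClosure F) n *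
          (algebraMap F (AlgebraicClosure F) m + algebraMap F (AlgebraicClosure F) n) * a ^ 3
        + algebraMap F (AlgebraicClosure F) n ^ 3 *
          (2 * algebraMap F (AlgebraicClosure F) m + algebraMap F (AlgebraicClosure F) n) * a * b
        - algebraMap F (AlgebraicClosure F) m ^ 2 * algebraMap F (AlgebraicClosure F) n ^ 4 * a ^ 2
        + algebraMap F (AlgebraicClosure F) m ^ 2 * algebraMap F (AlgebraicClosure F) n ^ 6 * b = 0 := by
  rw [kummerFn₇_eq_algebraMap, ord_some_algebraMap_pos_iff h (kummerCR₇_ne_zero m n),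
    pointEval_kummerCR₇]

/-- `T̄` is the affine point `(0, 0)`. [cite: Kubert1976, Table 3 (N = 7)] -/
theorem Tbar_eq : Tbar m n = Affine.Point.some 0 0 (nonsingular_zero_zero m n) := rfl

/-- A point `Q ≠ O` with `ord_Q f_T ≠ 0` is `T̄`. [cite: SilvermanAEC2009, Exercise 10.1(c) (PDF p. 304)] -/
theorem eq_Tbar_of_ord_ne_zero {Q : ((kubertTateSeven m n).baseChange (AlgebraicClosure F)).toAffine.Point}
    (hQ : Q ≠ 0) (hF : ord ((kubertTateSeven m n).baseChange (AlgebraicClosure F)).toAffine Q (kummerFn₇ m n) ≠ 0) :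
    Q = Affine.Point.some 0 0 (nonsingular_zero_zero m n) := by
  obtain ⟨hm, hn⟩ := m_n_ne_zero m n
  rcases Q with _ | ⟨a, b, h⟩
  · exact (hQ rfl).elim
  · have hpos : 0 < ord ((kubertTateSeven m n).baseChange (AlgebraicClosure F)).toAffine (.some a b h)
        (kummerFn₇ m n) :=
      lt_of_le_of_ne (ord_some_kummerFn₇_nonneg m n h) (Ne.symm hF)
    rw [ord_some_kummerFn₇_pos_iff m n h] at hpos
    obtain ⟨rfl, rfl⟩ := eq_zero_of_kummer₇_eq_zero hm hn ((nonsingular_geom_iff m n a b).mp h) hpos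
    rfl

/-- **`ord_T f_T = 7`** (the degree of the principal divisor `div f_T` is `0`, its only pole is
`O` of order `7` and its only zero is `T`).
[cite: SilvermanAEC2009, Exercise 10.1(c) (PDF p. 304) with Prop. II.3.1(b)] -/
theorem ord_Tbar_kummerFn₇ :
    ord ((kubertTateSeven m n).baseChange (AlgebraicClosure F)).toAffine
      (Affine.Point.some 0 0 (nonsingular_zero_zero m n)) (kummerFn₇ m n) = 7 := by
  set G : ((kubertTateSeven m n).baseChange (AlgebraicClosure F)).toAffine.Point → ℤ := fun Q =>
    ord ((kubertTateSeven m n).baseChange (AlgebraicClosure F)).toAffine Q (kummerFn₇ m n) with hG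
  set Z : Finset ((kubertTateSeven m n).baseChange (AlgebraicClosure F)).toAffine.Point :=
    {Affine.Point.some 0 0 (nonsingular_zero_zero m n)} with hZ
  have hZ0 : (0 : ((kubertTateSeven m n).baseChange (AlgebraicClosure F)).toAffine.Point) ∉ Z := by
    rw [hZ, Finset.mem_singleton]
    exact (Affine.Point.some_ne_zero _).symm
  have hzeros : ∀ Q : ((kubertTateSeven m n).baseChange (AlgebraicClosure F)).toAffine.Point,
      Q ≠ 0 → G Q ≠ 0 → Q ∈ Z := fun Q hQ hGQ => by
    rw [hZ, Finset.mem_singleton]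
    exact eq_Tbar_of_ord_ne_zero m n hQ hGQ
  obtain ⟨hcount, -⟩ := finsum_mul_eq_of_zeros G 7 (finite_support_ord (kummerFn₇_ne_zero m n))
    (finsum_ord (kummerFn₇_ne_zero m n)) (ord_zero_kummerFn₇ m n) Z hZ0 hzeros
  rw [hZ, Finset.sum_singleton] at hcount
  exact_mod_cast hcount

/-- **`div f_T = 7(T) - 7(O)`**: `ord_Q f_T = 7([Q = T̄] - [Q = O])` for every geometric point `Q` of
`E_{m,n}` — the divisor hypothesis of the tree's `WeierstrassCurve.exists_stableCoset_of_kummer_eq_pow`.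
[cite: SilvermanAEC2009, Exercise 10.1(c) (PDF p. 304)] [cite: Fisher2001FiveSevenDescent, §1] -/
theorem ord_kummerFn₇ (Q : geomPoints (kubertTateSeven m n)) :
    ord ((kubertTateSeven m n).baseChange (AlgebraicClosure F)).toAffine Q (kummerFn₇ m n) =
      ((7 : ℕ) : ℤ) * ((if Q = Tbar m n then 1 else 0) - (if Q = 0 then 1 else 0)) := by
  by_cases hQ0 : Q = 0
  · subst hQ0
    rw [if_neg (fun h => Tbar_ne_zero m n h.symm), if_pos rfl]
    exact (ord_zero_kummerFn₇ m n).trans (by norm_num)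
  by_cases hQT : Q = Tbar m n
  · subst hQT
    rw [if_pos rfl, if_neg (Tbar_ne_zero m n)]
    exact (ord_Tbar_kummerFn₇ m n).trans (by norm_num)
  · rw [if_neg hQT, if_neg hQ0, sub_zero, mul_zero]
    by_contra hF
    exact hQT ((eq_Tbar_of_ord_ne_zero m n hQ0 hF).trans (Tbar_eq m n).symm)

/-! ### Values at affine points -/

omit hE in
/-- **`f_T(x, y) = x²y - n(m+n)x³ + n³(2m+n)xy - m²n⁴x² + m²n⁶y`** at an affine geometric point.
[cite: SilvermanAEC2009, Exercise 10.1(c) (PDF p. 304)] [cite: Fisher2001FiveSevenDescent, §1] -/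
theorem hasValueAt_kummerFn₇ {x y : (AlgebraicClosure F)}
    (h : ((kubertTateSeven m n).baseChange (AlgebraicClosure F)).toAffine.Nonsingular x y) :
    (kubertTateSeven m n).HasValueAt (kummerFn₇ m n) (Affine.Point.some x y h)
      (x ^ 2 * y - algebraMap F (AlgebraicClosure F) n *
          (algebraMap F (AlgebraicClosure F) m + algebraMap F (AlgebraicClosure F) n) * x ^ 3
        + algebraMap F (AlgebraicClosure F) n ^ 3 *
          (2 * algebraMap F (AlgebraicClosure F) m + algebraMap F (AlgebraicClosure F) n) * x * y
        - algebraMap F (AlgebraicClosure F) m ^ 2 * algebraMap F (AlgebraicClosure F) n ^ 4 * x ^ 2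
        + algebraMap F (AlgebraicClosure F) m ^ 2 * algebraMap F (AlgebraicClosure F) n ^ 6 * y) := by
  have := hasValueAt_evalGeneric (W := kubertTateSeven m n) (kummerPoly₇ m n) (Affine.Point.some x y h)
  rw [xy_some] at this
  simpa [kummerPoly₇, kummerFn₇] using this

end KubertTateSevenKummer

end Literature.NumberTheory.EllipticCurves

end
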